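import Summits.CriticalPhenomena.PercolationContinuityZ3.Theorems.PercNearOneGluingNoHeavyLowerTailSunflowerCloneOps
import HarnessLib

/-!
# `NoHeavyLowerTail` (crux stmt-CriticalPhenomena-4575), abstract sunflower cubic: TRANSFER from the partition functional to three
# independent copies under a product measure — the exact composition identity, kernel-generic

Support file (seat `prim-l12-p2` gen 6; `--supports stmt-CriticalPhenomena-4575`; after `…SunflowerCloneCalculus`, `…SunflowerCloneOps`).  No `sorry`,
no named facts.  Memo: run/shared/lean/prim/prim-l12/prim-l12-p2/FINDING-g6-COMPOSITION-IDENTITY.md.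

THEOREM (`Mk_bern_nonneg_of_Zk_nonneg`, this work).  For any kernel `κ : Fin 5 → Fin 5 → Fin 5 → ℝ`: IF the partition functional
`Zk κ F.lab = Σ_{ordered 3-partitions} κ (lab P¹) (lab P²) (lab P³)` is `≥ 0` for every sunflower of up-sets on every finite ground type, THEN for every
sunflower `F` on a finite `E` and every `p : E → [0,1]` the THREE-INDEPENDENT-COPIES functional `Mk κ F.lab (bern ∘ p)`
(`= Σ_{S¹,S²,S³ ⊆ E} w_p(S¹) w_p(S²) w_p(S³) κ (lab S¹) (lab S²) (lab S³)`, `w_p` the product-measure weight; identification with the cubic form in the cell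
masses: `…SunflowerCloneLaw`) is `≥ 0`.  For `κ = s6H` (prim-ineq-prove-1 g25) the hypothesis is `PartitionLemmaH` and the conclusion gives `H_{q+t}`, `γ`,
`G₄` (and AG⁺, `T_inc`, 3PT-LB) on every finite weighted graph (`…SunflowerCloneHqt`).  This replaces the limiting cloning argument of the memo
ABSTRACT-SUNFLOWER-CUBIC-prove1-g25 §3 by a finite identity and removes its petal-foundedness proviso.
PROOF = an exact finite COMPOSITION IDENTITY, one Bernoulli coordinate at a time (potential `Σ_e (2 k_e + 1)` with `2^{k_e}(1 − p_e) ≥ 1/3`):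
`p_e = 1`: `bern 1 = clU`, CONTRACT (`Mk_con`);  `p_e ≤ 2/3`: SPLIT (`bern_split`) = DELETE + KEEP + DUPLICATE into two partition twins + CONTRACT
(`Mk_wsys_split`, coefficients `≥ 0`);  `2/3 < p_e < 1`: HALVE (`bern_uconv_bern`): a twin of weight `½` and `e` of weight `2p − 1` (`Mk_wsys_halve`).  The
duplications enlarge the ground type (`E ↦ Option E`), which is why the hypothesis quantifies over all finite types (universe `0`; the conclusion is lifted
to any universe by `Mk_reindex`).
-/

namespace Summit.CriticalPhenomena.PercolationContinuityZ3.Theorems.SunflowerPartition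

open Finset

section Functional

variable {E : Type*} [Fintype E] [DecidableEq E]

/-! ### Weight systems: Bernoulli on `R`, partition elsewhere -/

/-- The weight system with Bernoulli coordinates `R` (probabilities `p`) and partition coordinates elsewhere. [this work] -/
def wsys (R : Finset E) (p : E → ℝ) : E → Pat → ℝ := fun x => if x ∈ R then bern (p x) else cl1

/-- No Bernoulli coordinate: the partition functional. [this work] -/
theorem Mk_wsys_empty (κ : Fin 5 → Fin 5 → Fin 5 → ℝ) (lab : Finset E → Fin 5) (p : E → ℝ) :
    Mk κ lab (wsys ∅ p) = Zk κ lab := by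
  unfold wsys Zk
  simp

omit [Fintype E] in
/-- Single out a Bernoulli coordinate. [this work] -/
theorem wsys_eq_update {R : Finset E} (p : E → ℝ) {e : E} (he : e ∈ R) :
    wsys R p = Function.update (wsys R p) e (bern (p e)) := by
  funext x
  by_cases hx : x = e
  · subst hx; simp [wsys, he]
  · rw [Function.update_of_ne hx]

omit [Fintype E] in
/-- Turning a Bernoulli coordinate into a partition coordinate. [this work] -/
theorem wsys_update_cl1 (R : Finset E) (p : E → ℝ) (e : E) :
    Function.update (wsys R p) e cl1 = wsys (R.erase e) p := by
  funext x
  by_cases hx : x = e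
  · subst hx; simp [wsys]
  · rw [Function.update_of_ne hx]; simp [wsys, hx]

omit [Fintype E] in
/-- The weight system after duplicating `e` into two PARTITION twins. [this work] -/
theorem dupW_wsys_cl1 (R : Finset E) (p : E → ℝ) (e : E) :
    dupW (wsys R p) e cl1 cl1 = wsys ((R.erase e).map Function.Embedding.some) (fun o => o.elim 0 p) := by
  funext o
  cases o with
  | none => simp [dupW, wsys]
  | some x =>
    simp only [dupW, Option.elim_some]
    rw [wsys_update_cl1]
    simp [wsys]

omit [Fintype E] in
/-- The weight system after duplicating the Bernoulli coordinate `e` into Bernoulli twins of weights `a` (the twin) and `b` (`e`). [this work] -/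
theorem dupW_wsys_bern {R : Finset E} (p : E → ℝ) {e : E} (he : e ∈ R) (a b : ℝ) :
    dupW (wsys R p) e (bern a) (bern b) =
      wsys (insert none (R.map Function.Embedding.some)) (fun o => o.elim a (Function.update p e b)) := by
  funext o
  cases o with
  | none => simp [dupW, wsys]
  | some x =>
    simp only [dupW, Option.elim_some]
    by_cases hx : x = e
    · subst hx; simp [wsys, he]
    · rw [Function.update_of_ne hx]; simp [wsys, hx]

/-! ### The potential and the induction -/

/-- One step of the 4-term split, for sunflowers: `Mk` at a Bernoulli coordinate with `p ≤ 2/3` is a nonnegative combination of four functionals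
covered by the induction hypothesis. [this work] -/
theorem Mk_wsys_split (κ : Fin 5 → Fin 5 → Fin 5 → ℝ) (F : Sunflower E) {R : Finset E} (p : E → ℝ) {e : E} (he : e ∈ R) :
    Mk κ F.lab (wsys R p) =
      (1 - p e) ^ 3 * (1 / 3 * Mk κ (F.del e).lab (wsys (R.erase e) p)) +
      (p e * (1 - p e) ^ 2 - p e ^ 2 * (1 - p e) / 2) * Mk κ F.lab (wsys (R.erase e) p) +
      (p e ^ 2 * (1 - p e) / 2) * Mk κ (F.dup e).lab (wsys ((R.erase e).map Function.Embedding.some) (fun o => o.elim 0 p)) +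
      p e ^ 3 * (1 / 3 * Mk κ (F.con e).lab (wsys (R.erase e) p)) := by
  have eD : Mk κ (F.del e).lab (wsys (R.erase e) p) = 3 * Mk κ F.lab (Function.update (wsys R p) e cl0) := by
    rw [← wsys_update_cl1, Mk_del]
  have eK : Mk κ F.lab (wsys (R.erase e) p) = Mk κ F.lab (Function.update (wsys R p) e cl1) := by rw [wsys_update_cl1]
  have eP : Mk κ (F.dup e).lab (wsys ((R.erase e).map Function.Embedding.some) (fun o => o.elim 0 p)) =
      Mk κ F.lab (Function.update (wsys R p) e (uconv cl1 cl1)) := by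
    rw [← dupW_wsys_cl1, Mk_dup_sunflower]
  have eC : Mk κ (F.con e).lab (wsys (R.erase e) p) = 3 * Mk κ F.lab (Function.update (wsys R p) e clU) := by
    rw [← wsys_update_cl1, Mk_con]
  have eL : Mk κ F.lab (wsys R p) = Mk κ F.lab (Function.update (wsys R p) e (bern (p e))) := by rw [← wsys_eq_update p he]
  rw [eD, eK, eP, eC, eL, bern_split (p e), Mk_update_lin4]
  ring

/-- One halving step, for sunflowers: a Bernoulli coordinate `e` with `p > 2/3`... in fact any `p`: twins of weights `1/2` and `2p − 1`. [this work] -/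
theorem Mk_wsys_halve (κ : Fin 5 → Fin 5 → Fin 5 → ℝ) (F : Sunflower E) {R : Finset E} (p : E → ℝ) {e : E} (he : e ∈ R) :
    Mk κ F.lab (wsys R p) =
      Mk κ (F.dup e).lab (wsys (insert none (R.map Function.Embedding.some)) (fun o => o.elim (1 / 2) (Function.update p e (2 * p e - 1)))) := by
  rw [← dupW_wsys_bern p he, Mk_dup_sunflower, bern_uconv_bern]
  have h : (1 : ℝ) / 2 + (2 * p e - 1) - 1 / 2 * (2 * p e - 1) = p e := by ring
  rw [h, ← wsys_eq_update p he]

/-- The INDUCTION (on the potential `Σ_{x ∈ R} (2 k_x + 1)`). [this work] -/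
theorem Mk_wsys_nonneg_aux (κ : Fin 5 → Fin 5 → Fin 5 → ℝ)
    (HZ : ∀ (E : Type) [Fintype E] [DecidableEq E] (F : Sunflower E), 0 ≤ Zk κ F.lab) :
    ∀ (n : ℕ) (E : Type) [Fintype E] [DecidableEq E] (F : Sunflower E) (R : Finset E) (p : E → ℝ) (k : E → ℕ),
      (∀ x ∈ R, 0 ≤ p x ∧ p x ≤ 1) → (∀ x ∈ R, p x < 1 → (1 : ℝ) / 3 ≤ 2 ^ (k x) * (1 - p x)) →
      ∑ x ∈ R, (2 * k x + 1) ≤ n → 0 ≤ Mk κ F.lab (wsys R p) := by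
  intro n
  induction n with
  | zero =>
    intro E _ _ F R p k _ _ hpot
    have hR : R = ∅ := by
      rw [← Finset.card_eq_zero]
      have : R.card ≤ ∑ x ∈ R, (2 * k x + 1) := by
        rw [Finset.card_eq_sum_ones]
        exact Finset.sum_le_sum fun x _ => by omega
      omega
    subst hR
    rw [Mk_wsys_empty]
    exact HZ E F
  | succ n ih =>
    intro E _ _ F R p k hp hk hpot
    by_cases hR : R = ∅
    · subst hR
      rw [Mk_wsys_empty]
      exact HZ E F
    obtain ⟨e, he⟩ := Finset.nonempty_iff_ne_empty.2 hR
    have hpotR : ∑ x ∈ R.erase e, (2 * k x + 1) + (2 * k e + 1) = ∑ x ∈ R, (2 * k x + 1) := Finset.sum_erase_add R _ he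
    have hp' : ∀ x ∈ R.erase e, 0 ≤ p x ∧ p x ≤ 1 := fun x hx => hp x (mem_of_mem_erase hx)
    have hk' : ∀ x ∈ R.erase e, p x < 1 → (1 : ℝ) / 3 ≤ 2 ^ (k x) * (1 - p x) := fun x hx => hk x (mem_of_mem_erase hx)
    have hpot' : ∑ x ∈ R.erase e, (2 * k x + 1) ≤ n := by omega
    obtain ⟨h0, h1⟩ := hp e he
    by_cases hpe : p e = 1
    · -- contract
      have hc := Mk_con κ F (wsys R p) e
      rw [wsys_update_cl1] at hc
      have h := ih E (F.con e) (R.erase e) p k hp' hk' hpot'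
      rw [wsys_eq_update p he, hpe, bern_one]
      linarith
    by_cases h23 : p e ≤ 2 / 3
    · -- split into delete + keep + duplicate(partition twins) + contract
      rw [Mk_wsys_split κ F p he]
      have t1 := ih E (F.del e) (R.erase e) p k hp' hk' hpot'
      have t2 := ih E F (R.erase e) p k hp' hk' hpot'
      have t4 := ih E (F.con e) (R.erase e) p k hp' hk' hpot'
      have t3 : 0 ≤ Mk κ (F.dup e).lab (wsys ((R.erase e).map Function.Embedding.some) (fun o => o.elim 0 p)) := by
        refine ih (Option E) (F.dup e) _ _ (fun o => o.elim 0 k) ?_ ?_ ?_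
        · intro o ho
          rw [mem_map] at ho
          obtain ⟨x, hx, rfl⟩ := ho
          exact hp' x hx
        · intro o ho
          rw [mem_map] at ho
          obtain ⟨x, hx, rfl⟩ := ho
          exact hk' x hx
        · rw [sum_map]
          exact hpot'
      have c1 : 0 ≤ (1 - p e) ^ 3 := pow_nonneg (by linarith) 3
      have c2 := coeff_keep_nonneg h0 h23
      have c3 : 0 ≤ p e ^ 2 * (1 - p e) / 2 := div_nonneg (mul_nonneg (pow_nonneg h0 2) (by linarith)) (by norm_num)
      have c4 : 0 ≤ p e ^ 3 := pow_nonneg h0 3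
      have s1 := mul_nonneg c1 (mul_nonneg (by norm_num : (0:ℝ) ≤ 1 / 3) t1)
      have s2 := mul_nonneg c2 t2
      have s3 := mul_nonneg c3 t3
      have s4 := mul_nonneg c4 (mul_nonneg (by norm_num : (0:ℝ) ≤ 1 / 3) t4)
      linarith
    · -- halve: 2/3 < p e < 1, so k e = j + 1
      have hlt : p e < 1 := lt_of_le_of_ne h1 hpe
      have hke := hk e he hlt
      obtain ⟨j, hj⟩ : ∃ j, k e = j + 1 := by
        refine Nat.exists_eq_add_one_of_ne_zero fun h0' => ?_
        rw [h0', pow_zero, one_mul] at hke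
        linarith
      rw [Mk_wsys_halve κ F p he]
      refine ih (Option E) (F.dup e) _ _ (fun o => o.elim 0 (Function.update k e j)) ?_ ?_ ?_
      · intro o ho
        rw [mem_insert, mem_map] at ho
        rcases ho with rfl | ⟨x, hx, rfl⟩
        · norm_num
        · simp only [Function.Embedding.some_apply, Option.elim_some]
          by_cases hxe : x = e
          · subst hxe; simp only [Function.update_self]; constructor <;> linarith
          · rw [Function.update_of_ne hxe]; exact hp x hx
      · intro o ho
        rw [mem_insert, mem_map] at ho
        rcases ho with rfl | ⟨x, hx, rfl⟩
        · intro _; norm_num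
        · simp only [Function.Embedding.some_apply, Option.elim_some]
          by_cases hxe : x = e
          · subst hxe
            simp only [Function.update_self]
            intro _
            rw [hj, pow_succ] at hke
            linarith
          · rw [Function.update_of_ne hxe, Function.update_of_ne hxe]; exact hk x hx
      · have hnot : none ∉ R.map Function.Embedding.some := by simp
        rw [sum_insert hnot, sum_map]
        simp only [Option.elim_none, Function.Embedding.some_apply, Option.elim_some, mul_zero, zero_add]
        have hsplit : ∑ x ∈ R, (2 * Function.update k e j x + 1) =
            ∑ x ∈ R.erase e, (2 * Function.update k e j x + 1) + (2 * Function.update k e j e + 1) :=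
          (Finset.sum_erase_add R _ he).symm
        have hsame : ∑ x ∈ R.erase e, (2 * Function.update k e j x + 1) = ∑ x ∈ R.erase e, (2 * k x + 1) :=
          sum_congr rfl fun x hx => by rw [Function.update_of_ne (ne_of_mem_erase hx)]
        rw [hsplit, hsame, Function.update_self]
        omega

/-- Existence of the doubling level: for `p < 1` some `k` has `2^k (1 − p) ≥ 1/3`. [this work] -/
theorem exists_level {p : ℝ} (hp : p < 1) : ∃ k : ℕ, (1 : ℝ) / 3 ≤ 2 ^ k * (1 - p) := by
  obtain ⟨k, hk⟩ := pow_unbounded_of_one_lt (1 / (3 * (1 - p))) (by norm_num : (1 : ℝ) < 2)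
  refine ⟨k, ?_⟩
  have h1p : 0 < 1 - p := by linarith
  rw [div_lt_iff₀ (by positivity)] at hk
  linarith

/-- **TRANSFER THEOREM** (universe `0`): partition positivity of `κ` on all finite sunflowers ⇒ three-independent-copies positivity under every
product measure. [this work] -/
theorem Mk_bern_nonneg_of_Zk_nonneg₀ (κ : Fin 5 → Fin 5 → Fin 5 → ℝ)
    (HZ : ∀ (E : Type) [Fintype E] [DecidableEq E] (F : Sunflower E), 0 ≤ Zk κ F.lab)
    (E : Type) [Fintype E] [DecidableEq E] (F : Sunflower E) (p : E → ℝ) (hp : ∀ x, 0 ≤ p x ∧ p x ≤ 1) :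
    0 ≤ Mk κ F.lab (fun x => bern (p x)) := by
  classical
  have hw : (fun x => bern (p x)) = wsys univ p := by funext x; simp [wsys]
  rw [hw]
  let k : E → ℕ := fun x => if h : p x < 1 then Classical.choose (exists_level h) else 0
  refine Mk_wsys_nonneg_aux κ HZ _ E F univ p k (fun x _ => hp x) (fun x _ hx => ?_) le_rfl
  have := Classical.choose_spec (exists_level hx)
  simp only [k, dif_pos hx]
  exact this

/-- **TRANSFER THEOREM** (any universe, via `reindex`). [this work] -/
theorem Mk_bern_nonneg_of_Zk_nonneg (κ : Fin 5 → Fin 5 → Fin 5 → ℝ)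
    (HZ : ∀ (E : Type) [Fintype E] [DecidableEq E] (F : Sunflower E), 0 ≤ Zk κ F.lab)
    (F : Sunflower E) (p : E → ℝ) (hp : ∀ x, 0 ≤ p x ∧ p x ≤ 1) :
    0 ≤ Mk κ F.lab (fun x => bern (p x)) := by
  let g : Fin (Fintype.card E) ≃ E := (Fintype.equivFin E).symm
  have key : Mk κ (F.reindex g).lab (fun i => bern (p (g i))) = Mk κ F.lab (fun x => bern (p x)) :=
    Mk_reindex κ F (fun x => bern (p x)) g
  rw [← key]
  exact Mk_bern_nonneg_of_Zk_nonneg₀ κ HZ (Fin (Fintype.card E)) (F.reindex g) (fun i => p (g i)) (fun i => hp (g i))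

end Functional

end Summit.CriticalPhenomena.PercolationContinuityZ3.Theorems.SunflowerPartition
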